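import Literature.AlgebraicGeometry.Frobenioids.BirationalizationFunctor
import Literature.AlgebraicGeometry.Frobenioids.BiratLocalizationUniversal
import Literature.AlgebraicGeometry.Frobenioids.BiratSubfunctor
import Literature.AlgebraicGeometry.Frobenioids.CoAngular
import Literature.AlgebraicGeometry.Frobenioids.DivisorMonoidCategoryTheoreticityDefs
import Literature.AlgebraicGeometry.Frobenioids.PreFrobenioidDataOfFunctor
import HarnessLib

/-!
# Frobenioids I, Prop. 4.4: the birationalization as a `PreFrobenioidData.BiratData`; (i), (ii) hold

Mochizuki, *The geometry of Frobenioids I*, Kyushu J. Math. **62** (2008), Prop. 4.4 (i)–(iii)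
pp. 82–83 [cite: MochizukiFrdI2008, Prop. 4.4 p.82]. The INTERFACE `PreFrobenioidData.BiratData`
(`DivisorMonoidCategoryTheoreticityDefs.lean`, seat abc-iut-L1-t3; over which Prop. 4.4 (i)–(iv),
Def. 4.5 and §5 are typed) is INSTANTIATED for `PreFrobenioidData.ofFunctor Φ F`, `F : C ⥤ F_Φ` a
Frobenioid, by THE birationalization (seat abc-iut-L6-t8): `C^birat = Birat F hF hsq`,
`C → C^birat = toBirat F hF hsq` (`BirationalizationCategory.lean`), operations over `0_D` through
`C^birat → F_{Φ^gp} → F_{0_D}` (`Birat.toElemZero`, `BirationalizationFunctor.lean`), the rational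
function monoid `Φ^birat := biratSubgroup F` (seat abc-iut-L1-t5, RULING C5′), and the divisor
homomorphism `O^×(A^birat) → Φ^gp(Base A)`, `u ↦ Div(u)` read in `F_{Φ^gp}` (`biratDivHom`), whose
values lie in `Φ^birat(Base A)` because a unit of `A^birat` is a class `[(α, φ')]` with `φ'` a
PRE-STEP base-equivalent to the co-angular pre-step `α` (`biratDivHom_mem`, the germ of
`BiratSubfunctor.lean`). RESULT (RULING C5‴ (c), seat abc-iut-L6-t6): `biratData hF hsq`, and
**Prop. 4.4 (i), (ii) AS TYPED over the interface HOLD for it** (`prop44i_biratData`,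
`prop44ii_biratData`). The hypothesis `hsq : HasBiratSquares F` is discharged for every Frobenioid by
`hasBiratSquares_of_isFrobenioid` (`BiratLocalization.lean`).
-/

namespace Literature.AlgebraicGeometry.Frobenioids

open CategoryTheory Opposite

namespace PreFrobenioid

universe w v v' u u'

variable {D : Type u} [Category.{v} D] {Φ : Dᵒᵖ ⥤ CommMonCat.{w}}
  {C : Type u'} [Category.{v'} C] {F : C ⥤ ElemFrobenioid Φ}
  (hF : IsFrobenioid F) (hsq : HasBiratSquares F)

/-! ### The operations of `C^birat` over `0_D` -/

/-- The pre-Frobenioid operations of `C^birat` over `D` with the ZERO divisor monoid: those of the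
functor `C^birat → F_{0_D}` ([FrdI] Prop. 4.4 (ii) "the Frobenioid structure determined by
`C^birat → F_{0_D}`"). [cite: MochizukiFrdI2008, Prop. 4.4 (ii) p.83] -/
noncomputable abbrev biratOps : PreFrobenioidData.{w} (Birat F hF hsq) D :=
  PreFrobenioidData.ofFunctor (zeroMonoid D) (Birat.toElemZero hF hsq)

/-- The divisor monoid of `C^birat → F_{0_D}` is `0_D`. [cite: MochizukiFrdI2008, Prop. 4.4 (ii) p.83] -/
theorem biratOps_mon_eq_one (X : D) (x : (biratOps hF hsq).Mon X) : x = 1 := rfl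

variable {hF hsq}

/-- `Base(-)` of `C^birat → F_{0_D}` on the image of `φ ∈ Hom_C(A, B)` is `Base(φ)`.
[cite: MochizukiFrdI2008, Prop. 4.4 (i) p.83] -/
theorem biratOps_base_map_toBirat {A B : C} (φ : A ⟶ B) :
    (biratOps hF hsq).base.map ((toBirat F hF hsq).map φ) = Base F φ := by
  change ElemFrobenioid.Base ((ElemFrobenioid.mapNatTrans (toZeroMonoid (monoidGp Φ))).map
    ((toBirat F hF hsq ⋙ Birat.toElemGp hF hsq).map φ)) = Base F φ
  rw [toBirat_comp_toElemGp_map hF hsq φ]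
  rfl

/-- `deg_Fr(-)` of `C^birat → F_{0_D}` on the image of `φ` is `deg_Fr(φ)` (Prop. 4.4 (i): `C → C^birat`
preserves Frobenius degrees). [cite: MochizukiFrdI2008, Prop. 4.4 (i) p.83] -/
theorem biratOps_degFr_toBirat {A B : C} (φ : A ⟶ B) :
    (biratOps hF hsq).degFr ((toBirat F hF hsq).map φ) = degFr F φ := by
  change ElemFrobenioid.degFr ((ElemFrobenioid.mapNatTrans (toZeroMonoid (monoidGp Φ))).map
    ((toBirat F hF hsq ⋙ Birat.toElemGp hF hsq).map φ)) = degFr F φ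
  rw [toBirat_comp_toElemGp_map hF hsq φ]
  rfl

/-- `Base(-)` of `C^birat → F_{0_D}` on a class of fractions `[(α, φ')]` is `Base(α)⁻¹ ≫ Base(φ')`.
[cite: MochizukiFrdI2008, Prop. 4.4 (i) p.84] -/
theorem biratOps_base_map_homMk {X Y : Birat F hF hsq} (f : BiratFrac F X.out Y.out) :
    (biratOps hF hsq).base.map (Birat.homMk f) = BiratFrac.base f := rfl

/-- `deg_Fr(-)` of `C^birat → F_{0_D}` on `[(α, φ')]` is `deg_Fr(φ')`. [cite: MochizukiFrdI2008, Prop. 4.4 (i) p.84] -/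
theorem biratOps_degFr_homMk {X Y : Birat F hF hsq} (f : BiratFrac F X.out Y.out) :
    (biratOps hF hsq).degFr (Birat.homMk f) = BiratFrac.deg f := rfl

/-- `C → C^birat → D` is `Base(-)` on the nose. [cite: MochizukiFrdI2008, Prop. 4.4 (i) p.83] -/
theorem toBirat_comp_biratOps_base :
    toBirat F hF hsq ⋙ (biratOps hF hsq).base = (PreFrobenioidData.ofFunctor Φ F).base :=
  CategoryTheory.Functor.hext (fun _ => rfl) (fun _ _ φ => heq_of_eq (biratOps_base_map_toBirat φ))

variable (hF hsq) in
/-- `C → C^birat` lies over `D`: `toBirat ⋙ Base ≅ Base`. [cite: MochizukiFrdI2008, Prop. 4.4 (i) p.83] -/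
noncomputable def biratOverBase :
    toBirat F hF hsq ⋙ (biratOps hF hsq).base ≅ (PreFrobenioidData.ofFunctor Φ F).base :=
  eqToIso toBirat_comp_biratOps_base

/-! ### The divisor homomorphism `O^×(A^birat) → Φ^gp(Base A)` and its values -/

/-- A unit `u ∈ O^×(A^birat)` (base-identity linear automorphism for `C^birat → F_{0_D}`), written as a
class `[(α, φ')]`, has `Base(φ') = Base(α)` and `deg_Fr(φ') = 1`; in particular `φ'` is a pre-step
base-equivalent to `α`. [cite: MochizukiFrdI2008, Prop. 4.4 (iii) p.84] -/
theorem isPreStep_num_of_mem_unitsSubgroup {A : C}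
    (u : (biratOps hF hsq).unitsSubgroup ((toBirat F hF hsq).obj A))
    (f : BiratFrac F A A) (hf : Birat.homMk f = u.1.hom) :
    IsPreStep F f.num ∧ BaseEquivalent F f.den f.num := by
  obtain ⟨hb, hl⟩ := u.2
  haveI : IsIso (Base F f.den) := f.den_mem.2.2
  have hbase : Base F f.num = Base F f.den := by
    have h : (biratOps hF hsq).base.map (Birat.homMk f) = 𝟙 _ := by rw [hf]; exact hb
    rw [biratOps_base_map_homMk] at h
    have h' : inv (Base F f.den) ≫ Base F f.num = 𝟙 (baseObj F A) := h
    rw [IsIso.inv_comp_eq, Category.comp_id] at h'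
    exact h'
  have hdeg : degFr F f.num = 1 := by
    have h : (biratOps hF hsq).degFr (Birat.homMk f) = 1 := by rw [hf]; exact hl
    rwa [biratOps_degFr_homMk] at h
  refine ⟨⟨hdeg, ?_⟩, hbase.symm⟩
  change IsIso (Base F f.num); rw [hbase]; infer_instance

/-- For a fraction `(α, φ')` with `φ'` a pre-step base-equivalent to `α`, the `Φ^gp`-divisor
`Φ(α)⁻¹{Div φ' − Div α}` is the INVERSE of the birational germ of the pair `(α, φ')`
(`BiratSubfunctor.lean`), hence lies in `Φ^birat(Base A)`. [cite: MochizukiFrdI2008, Prop. 4.4 (iii) p.83] -/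
theorem divGp_mem_biratSubgroup {A : C} (f : BiratFrac F A A) (hnum : IsPreStep F f.num)
    (hb : BaseEquivalent F f.den f.num) :
    BiratFrac.divGp f ∈ biratSubgroup F (baseObj F A) := by
  haveI : IsIso (Base F f.den) := f.den_mem.2.2
  haveI : IsIso (Base F f.num) := hnum.2
  have hdeg : (BiratFrac.deg f : ℕ) = 1 := by
    change (degFr F f.num : ℕ) = 1; rw [hnum.1]; rfl
  have key : BiratFrac.divGp f =
      (Algebra.GrothendieckGroup.of (invDiv F f.den f.den_mem.2.2) /
        Algebra.GrothendieckGroup.of (invDiv F f.num hnum.2))⁻¹ := by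
    rw [inv_div, BiratFrac.divGp, hdeg, pow_one, map_div, pullGp_of', pullGp_of']
    congr 2
    · change pull Φ (inv (Base F f.den)) (Div F f.num) = pull Φ (inv (Base F f.num)) (Div F f.num)
      congr 2
      exact IsIso.inv_eq_inv.mpr hb
  rw [key]
  exact Subgroup.inv_mem _ (div_invDiv_mem_biratSubfunctor F f.den f.num f.den_mem hnum hb)

variable (hF hsq) in
/-- **The divisor homomorphism `O^×(A^birat) → Φ(Base A)^gp`** of [FrdI] Prop. 4.4 (iii): the divisor
of a unit read through `C^birat → F_{Φ^gp}`. (It is a homomorphism because units are base-identity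
and linear: `Div(v ≫ u) = Div(u) · Div(v)`.) [cite: MochizukiFrdI2008, Prop. 4.4 (iii) p.83] -/
noncomputable def biratDivHom (A : C) :
    (biratOps hF hsq).unitsSubgroup ((toBirat F hF hsq).obj A) →*
      Algebra.GrothendieckGroup (Φ.obj (op (baseObj F A))) where
  toFun u := ElemFrobenioid.Div ((Birat.toElemGp hF hsq).map u.1.hom)
  map_one' := by
    change ElemFrobenioid.Div ((Birat.toElemGp hF hsq).map (𝟙 _)) = 1
    rw [(Birat.toElemGp hF hsq).map_id]; rfl
  map_mul' u v := by
    obtain ⟨hbv, -⟩ := v.2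
    obtain ⟨-, hlu⟩ := u.2
    have hbv' : ElemFrobenioid.Base ((Birat.toElemGp hF hsq).map v.1.hom) = 𝟙 _ := hbv
    have hlu' : ElemFrobenioid.degFr ((Birat.toElemGp hF hsq).map u.1.hom) = 1 := hlu
    change ElemFrobenioid.Div ((Birat.toElemGp hF hsq).map (v.1.hom ≫ u.1.hom)) = _
    rw [Functor.map_comp, ElemFrobenioid.div_comp, hbv', hlu', pull_id, PNat.one_coe, pow_one]
    rfl

/-- `biratDivHom` on a unit written as a class of fractions is the `Φ^gp`-divisor of the fraction.
[cite: MochizukiFrdI2008, Prop. 4.4 (iii) p.84] -/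
theorem biratDivHom_apply_of_eq {A : C} (u : (biratOps hF hsq).unitsSubgroup ((toBirat F hF hsq).obj A))
    (f : BiratFrac F A A) (hf : Birat.homMk f = u.1.hom) :
    biratDivHom hF hsq A u = BiratFrac.divGp f := by
  change ElemFrobenioid.Div ((Birat.toElemGp hF hsq).map u.1.hom) = _
  rw [← hf]
  rfl

/-- **The divisor of a unit of `A^birat` lies in `Φ^birat(Base A)`** ([FrdI] Prop. 4.4 (iii): the image
of `O^×(A^birat) → Φ^gp` is the rational function monoid). [cite: MochizukiFrdI2008, Prop. 4.4 (iii) p.83] -/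
theorem biratDivHom_mem {A : C} (u : (biratOps hF hsq).unitsSubgroup ((toBirat F hF hsq).obj A)) :
    biratDivHom hF hsq A u ∈ biratSubgroup F (baseObj F A) := by
  obtain ⟨f, hf⟩ := Birat.homMk_surjective u.1.hom
  obtain ⟨hnum, hb⟩ := isPreStep_num_of_mem_unitsSubgroup u f hf
  rw [biratDivHom_apply_of_eq u f hf]
  exact divGp_mem_biratSubgroup f hnum hb

/-! ### The `BiratData` instance and Prop. 4.4 (i), (ii) -/

variable (hF hsq) in
/-- **The birationalization as a `BiratData`** for `PreFrobenioidData.ofFunctor Φ F`.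
[cite: MochizukiFrdI2008, Prop. 4.4 p.82] -/
noncomputable def biratData : (PreFrobenioidData.ofFunctor Φ F).BiratData where
  Birat := Birat F hF hsq
  toBirat := toBirat F hF hsq
  obj_surjective X := ⟨X.out, rfl⟩
  ops := biratOps hF hsq
  ops_mon_eq_one := biratOps_mon_eq_one hF hsq
  overBase := biratOverBase hF hsq
  phiBirat X := biratSubgroup F X
  divBirat A := biratDivHom hF hsq A
  divBirat_mem _ u := biratDivHom_mem u

/-- **[FrdI] Prop. 4.4 (i)** as typed over the interface (`Prop44i`) HOLDS for the birationalization: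
`C → C^birat` lies over `D` and preserves Frobenius degrees. [cite: MochizukiFrdI2008, Prop. 4.4 (i) p.83] -/
theorem prop44i_biratData : PreFrobenioidData.Prop44i (biratData hF hsq) :=
  ⟨⟨biratOverBase hF hsq⟩, fun _ _ φ => biratOps_degFr_toBirat φ⟩

/-- **[FrdI] Prop. 4.4 (ii)** as typed over the interface (`Prop44ii`) HOLDS for the birationalization
of a Frobenioid: group-like type, `C → C^birat` faithful, and a base-identity linear endomorphism of
`A` (co-angular by Def. 1.3 (iii)(b), hence a co-angular pre-step) becomes a base-identity linear
ISOMORPHISM of `A^birat`. [cite: MochizukiFrdI2008, Prop. 4.4 (ii) p.83] -/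
theorem prop44ii_biratData : PreFrobenioidData.Prop44ii (biratData hF hsq) := by
  refine ⟨⟨fun _ _ => rfl⟩, toBirat_faithful hF hsq, fun A α hα => ?_⟩
  obtain ⟨hb, hl⟩ := hα
  have hb' : Base F (show A ⟶ A from α) = 𝟙 _ := hb
  have hl' : degFr F (show A ⟶ A from α) = 1 := hl
  have hpre : IsCoAngularPreStep F (show A ⟶ A from α) :=
    ⟨isCoAngular_endo F hF _, hl', by change IsIso (Base F (show A ⟶ A from α)); rw [hb']; infer_instance⟩
  refine ⟨toBirat_inverts hF hsq _ hpre, ?_, ?_⟩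
  · change (biratOps hF hsq).base.map ((toBirat F hF hsq).map (show A ⟶ A from α)) = 𝟙 _
    rw [biratOps_base_map_toBirat, hb']
    rfl
  · change (biratOps hF hsq).degFr ((toBirat F hF hsq).map (show A ⟶ A from α)) = 1
    rw [biratOps_degFr_toBirat, hl']

end PreFrobenioid

end Literature.AlgebraicGeometry.Frobenioids
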